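import Literature.NumberTheory.EllipticCurves.PeriodIndex
import Literature.NumberTheory.EllipticCurves.PeriodIndexProofs
import Literature.NumberTheory.EllipticCurves.SelmerProofs
import HarnessLib

/-!
# Period divides index; Cassels' `I = P` on `Ш` reduced to its hard half

Sibling of `Literature/NumberTheory/EllipticCurves/PeriodIndex` (D-0014 decomposition of
`Literature.Barriers.BirchSwinnertonDyer.ClarkSharif2010_thm3`, Clark–Sharif 2010, Theorem 3),
under its part `Literature.NumberTheory.EllipticCurves.Cassels1962_index_eq_period_of_mem_sha`
("(ii) (Cassels) `F` is global and `C ∈ Ш(F, E)`, then `P = I`", Clark–Sharif §3.7; §1.3: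
"Cassels showed that `I = P` for classes with empty support"). With the paper's definitions
(§1.1: the period `P(η)` of `η ∈ H¹(K, E)` is its order, the index `I(η)` is the gcd of the
degrees `[L : K]` of the finite extensions `L/K` with `η|_L = 0`; the tree's `addOrderOf η` and
`Literature.NumberTheory.EllipticCurves.index`), the equality `I = P` on `Ш` has two halves of
very different depth:

* **`P ∣ I`, for every class over every (perfect) field** — "It is well known (e.g. [WCII]) that
  the period `P` and the index `I` of `C` satisfy the divisibilities `P ∣ I ∣ P²`" (Clark–Sharif
  §1.3, eq. (1); Lang–Tate 1958). `P ∣ I` is the corollary `cor ∘ res = [L : K]` of Serre,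
  *Galois Cohomology*, I.§2.4: a class dying over `L` is killed by `[L : K]`, so the period divides
  every splitting degree, hence their gcd. **Proved here** (`addOrderOf_dvd_index`), through the
  general "`[L : K]` kills `ker (H¹(K, E) → H¹(L, E))`" for an arbitrary finite extension `L/K`
  (`finrank_nsmul_mem_localRestrictionKer_eq_zero`; the tree had it for `L/K` Galois only,
  `Literature.NumberTheory.EllipticCurves.finrank_nsmul_eq_zero_of_mem_localRestrictionKer`),
  obtained without corestriction exactly as in `ShaRestrictionIndex`: the kernel of restriction is
  inflated from crossed homomorphisms vanishing on the open subgroup `Γ_{L'} ≤ Γ_K` of the copy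
  `L' ⊂ K̄` of `L` cut out by the chosen isomorphism `K̄ ≃ L̄`
  (`Literature.NumberTheory.EllipticCurves.resKer_le_range_inflClass`), such classes are killed by
  `[Γ_K : Γ_{L'}]` (`Literature.NumberTheory.EllipticCurves.index_nsmul_inflClass`), and
  `[Γ_K : Γ_{L'}] = [L' : K] = [L : K]` (Krull topology,
  `IntermediateField.finrank_eq_fixingSubgroup_index`).
* **`I ∣ P` on `Ш`** — the theorem of Cassels (Arithmetic on curves of genus 1, IV, 1962); printed
  proof read: Clark 2006, Prop. 6 ("Let `C/K` be a genus one curve over a number field whose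
  corresponding class `η` lies in `𝒦(K, Jac(C))`. Then every rational divisor class on `C` admits
  a rational divisor. In particular, the period and index of `η` are equal.") with Prop. 5(a)
  (`Ш(K, E) ⊂ 𝒦(K, E)`): the obstruction to representing a `K`-rational divisor class by a
  `K`-rational divisor lives in `Br(K)` (Leray: `0 → Pic C → (Pic C_K̄)^{g_K} → Br K → Br C`;
  equivalently O'Neil's period-index obstruction `Δ : H¹(K, E[n]) → Br(K)[n]`), it vanishes at
  every place where `C` has a point, hence vanishes by the reciprocity law for the Brauer group of
  a number field (Albert–Brauer–Hasse–Noether, global class field theory); a rational divisor class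
  of degree `P` exists since `P · η = 0`, so there is a rational divisor of degree `P` and `I ∣ P`.
  None of the Brauer group of a global field with its local invariants, the reciprocity law, or
  the torsor/divisor dictionary for `H¹(K, E)` is in Mathlib or the tree, so this half is NOT
  proved here, and (D-0026) it is not re-vendored as a further named fact either: it stays
  recorded by the named fact of `PeriodIndex` itself, of which it is now the whole content.
* **Reduction** (`index_eq_addOrderOf_of_index_dvd`,
  `Cassels1962_index_eq_period_of_mem_sha_of_index_dvd`): `I = P` for a class as soon as `I ∣ P`
  for it, and `Literature.NumberTheory.EllipticCurves.Cassels1962_index_eq_period_of_mem_sha`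
  from the divisibility `I ∣ P` on `Ш` (`Nat.dvd_antisymm`; no separate input "every class splits
  over some finite extension" is needed: were there no splitting degree, `I` would be the junk
  value `0` and `I ∣ P` forces `P = 0 = I`).
* **Selmer form** (`Cassels1962_index_eq_period_of_mem_sha_iff_selmer`): the named fact is
  EQUIVALENT to "for every elliptic curve `E` over a number field `K`, every `n > 0` and every
  `ξ ∈ Sel^(n)(E/K)`, the image of `ξ` in `H¹(K, E)` has index dividing `n`" — the statement the
  first printed proof of Clark 2006, Prop. 6 actually establishes ("a class `η ∈ H¹(K, E)[n]` has
  index dividing `n` if and only if there exists some Kummer lift of `η` to `ξ ∈ H¹(K, E[n])`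
  such that `Δ(ξ) = 0` […] By virtue of the reciprocity law in the Brauer group of a number
  field, we have that `Δ(ξ) = 0`, so `η` has index dividing `n`"), the Kummer lifts of a class of
  `Ш` being its Selmer lifts (Silverman, *AEC*, Thm. X.4.2(a), in the tree as
  `WeierstrassCurve.map_torsionH1ToH1_selmerGroup_holds`).
* **Standard trick** (`Cassels1962_index_eq_period_of_mem_sha_iff_isPrimePow`,
  `Cassels1962_index_eq_period_of_mem_sha_of_selmer_isPrimePow`): "in all work on the
  period-index problem it suffices to treat the case where the period `P` is a prime power"
  (Clark–Sharif §3, opening paragraph) — the named fact is EQUIVALENT to its restriction to the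
  classes of `Ш` of prime-power period, and follows from its Selmer form at prime-power levels
  `n = p^a` only, through the sub-multiplicativity of the index `I(δ + ε) ∣ I(δ) I(ε)`
  (`index_add_dvd_mul_index`, from the common splitting fields of
  `Literature.NumberTheory.EllipticCurves.exists_splittingDegrees_add`) applied to the primary
  decomposition of a class inside `Ш`.

## Main statements

* `exists_intermediateField_fixingSubgroup_le_range_resGal`: for `M/K` finite there is a copy
  `F = e⁻¹(M) ⊂ K̄` of `M` (`e : K̄ ≃ M̄` the chosen isomorphism), `[F : K] = [M : K]`, whose
  group `Γ_F = Gal(K̄/F)` lies in the image of the restriction `Γ_M → Γ_K`.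
* `finrank_nsmul_mem_localRestrictionKer_eq_zero`: `[M : K]` kills `ker (H¹(K, E) → H¹(M, E))`
  for every finite extension `M` of a perfect field `K` (Serre, I.§2.4, Cor. to Prop. 9).
* `addOrderOf_dvd_of_mem_splittingDegrees`, `addOrderOf_dvd_index`: `P ∣ d` for every splitting
  degree `d`, and `P ∣ I` (Clark–Sharif §1.3 (1)).
* `index_eq_addOrderOf_of_index_dvd`, `Cassels1962_index_eq_period_of_mem_sha_of_index_dvd`:
  `I = P` from `I ∣ P`, pointwise and for the named fact of `PeriodIndex`.
* `exists_normal_mem_localRestrictionKer`, `splittingDegrees_nonempty`, `index_ne_zero`,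
  `galH1_addOrderOf_pos`, `galH1_isTorsion`: every class of `H¹(K, E)` dies over a finite normal
  extension of `K` inside `K̄` (Serre, I.§2.2, Cor. 1 to Prop. 8), so the index is never the
  junk value `0`, and (over a perfect field) every class has finite order — `H¹(K, E)` is a
  torsion group (Serre, I.§2.2, Cor. 3 to Prop. 8).
* `torsionH1ToH1_mem_sha_of_mem_selmerGroup`, `exists_mem_selmerGroup_of_mem_sha`: Selmer
  classes map into `Ш`, and every class of `Ш` killed by `n ≠ 0` has a Selmer lift (Silverman,
  X.4.2(a), elementwise); `index_torsionH1ToH1_dvd_of_mem_selmerGroup`,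
  `index_dvd_addOrderOf_of_mem_sha_of_selmer`, `Cassels1962_index_eq_period_of_mem_sha_of_selmer`,
  `Cassels1962_index_eq_period_of_mem_sha_iff_selmer`: the named fact ⇔ its Selmer form.
* `index_add_dvd_mul_index`, `index_sum_dvd_prod_index`: sub-multiplicativity of the index over
  a field of characteristic `0`; `index_dvd_of_mem_sha_of_nsmul_eq_zero_of_isPrimePow`,
  `index_dvd_addOrderOf_of_mem_sha_of_isPrimePow`: the standard trick on `Ш`, curve by curve;
  `Cassels1962_index_eq_period_of_mem_sha_of_isPrimePow`, `…_iff_isPrimePow`,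
  `…_of_selmer_isPrimePow`: the named fact from (⇔) its prime-power case, and from its Selmer
  form at prime-power levels.

## References

* P. L. Clark, S. Sharif, *Period, index and potential. III*, Algebra Number Theory 4 (2010)
  151–174, §1.1, §1.3 eq. (1), §3 (opening paragraph: the standard trick), §3.7 (ii)
  (`ClarkSharif2010`; arXiv:0811.3019 read, pp. 3, 9, 13).
* P. L. Clark, *There are genus one curves of every index over every number field*, J. reine
  angew. Math. 594 (2006) 201–206, §2, Props. 5–6 with both printed proofs of Prop. 6
  (`Clark2006Crelle`; arXiv:math/0411413 read, pp. 3–5).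
* J. W. S. Cassels, *Arithmetic on curves of genus 1. IV. Proof of the Hauptvermutung*, J. reine
  angew. Math. 211 (1962) 95–112 (`Cassels1962ArithmeticIV`; NOT read — not held; cited through
  the two sources above).
* J.-P. Serre, *Galois Cohomology* (1997), I.§2.2, Prop. 8 with Cor. 1 and Cor. 3 (p. 13 of the
  held text read); I.§2.4, Prop. 9 and Cor. (`SerreGaloisCohomology1997`).
* S. Lang, J. Tate, *Principal homogeneous spaces over abelian varieties*, Amer. J. Math. 80
  (1958) 659–684 (`LangTate1958`; NOT read — `P ∣ I ∣ P²` as reported by Clark–Sharif §1.3).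
* J. H. Silverman, *The Arithmetic of Elliptic Curves*, 2nd ed. (2009), Thm. X.4.2(a)
  (`SilvermanAEC2009`; the exact sequence `0 → E(K)/nE(K) → Sel^(n)(E/K) → Ш(E/K)[n] → 0`, used
  through the tree's discharged `WeierstrassCurve.map_torsionH1ToH1_selmerGroup_holds`).
-/

noncomputable section

open scoped Classical

universe u

namespace Literature.NumberTheory.EllipticCurves

/-! ### `[M : K]` kills the kernel of `H¹(K, E) → H¹(M, E)` for an arbitrary finite `M/K` -/

section CorRes

variable {K : Type u} [Field K] (M : Type u) [Field M] [Algebra K M]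

/-- **A copy of `M` inside `K̄` whose group lies in the image of `Γ_M → Γ_K`.** For a finite
extension `M/K`, the chosen `K`-embedding `closureEmb M : K̄ → M̄` is an isomorphism `e`
(`Literature.NumberTheory.EllipticCurves.algEquivOfEmb`); let `F = e⁻¹(M) ⊂ K̄` be the field
range of the `K`-embedding `j = e⁻¹ ∘ (M → M̄) : M → K̄`. Then `[F : K] = [M : K]` (`j` is an
isomorphism onto `F`, `AlgHom.equivFieldRange`), and `Γ_F = Gal(K̄/F)` lies in the image of the
restriction `Γ_M → Γ_K`: an automorphism `τ` of `K̄/K` fixing `F` pointwise becomes, transported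
through `e`, an automorphism `e τ e⁻¹` of `M̄` fixing `M` pointwise, i.e. an element `σ ∈ Γ_M`,
whose restriction to `K̄` along `e` is `τ`
(`Literature.NumberTheory.EllipticCurves.apply_resGalAuxOfEmb_apply`) — the argument of
`Literature.NumberTheory.EllipticCurves.galSubgroupClosure_le_range_resGal` with the Galois
closure replaced by `F`. Serre, *Galois Cohomology*, II.§1.1. [folklore] -/
theorem exists_intermediateField_fixingSubgroup_le_range_resGal [FiniteDimensional K M] :
    ∃ F : IntermediateField K (AlgebraicClosure K), FiniteDimensional K F ∧
      Module.finrank K F = Module.finrank K M ∧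
        F.fixingSubgroup ≤
          ((resGal (K := K) M : Field.absoluteGaloisGroup M →ₜ* Field.absoluteGaloisGroup K) :
            Field.absoluteGaloisGroup M →* Field.absoluteGaloisGroup K).range := by
  let ι : AlgebraicClosure K →ₐ[K] AlgebraicClosure M := closureEmb (K := K) M
  let e : AlgebraicClosure K ≃ₐ[K] AlgebraicClosure M := algEquivOfEmb M ι
  let j : M →ₐ[K] AlgebraicClosure K :=
    (e.symm : AlgebraicClosure M →ₐ[K] AlgebraicClosure K).comp
      (IsScalarTower.toAlgHom K M (AlgebraicClosure M))
  have hj : ∀ x : M, j x ∈ j.fieldRange := fun x ↦ ⟨x, rfl⟩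
  refine ⟨j.fieldRange, LinearEquiv.finiteDimensional j.equivFieldRange.toLinearEquiv,
    j.equivFieldRange.toLinearEquiv.finrank_eq.symm, fun τ hτ ↦ ?_⟩
  let τ' : AlgebraicClosure K ≃ₐ[K] AlgebraicClosure K := τ
  -- the ring automorphism `e ∘ τ ∘ e⁻¹` of `M̄`
  let r : AlgebraicClosure M ≃+* AlgebraicClosure M :=
    (e.symm.toRingEquiv.trans τ'.toRingEquiv).trans e.toRingEquiv
  have hr : ∀ z, r z = e (τ' (e.symm z)) := fun z ↦ rfl
  have hrM : ∀ x : M, r (algebraMap M (AlgebraicClosure M) x) =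
      algebraMap M (AlgebraicClosure M) x := by
    intro x
    rw [hr]
    have h1 : e.symm (algebraMap M (AlgebraicClosure M) x) = j x := rfl
    rw [h1, (IntermediateField.mem_fixingSubgroup_iff _ _).mp hτ (j x) (hj x), ← h1,
      AlgEquiv.apply_symm_apply]
  let σ : AlgebraicClosure M ≃ₐ[M] AlgebraicClosure M := AlgEquiv.ofRingEquiv (f := r) hrM
  refine ⟨σ, ?_⟩
  apply AlgEquiv.ext
  intro z
  apply ι.injective
  change ι ((show AlgebraicClosure K ≃ₐ[K] AlgebraicClosure K from resGalAuxOfEmb ι σ) z) = ι (τ' z)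
  rw [apply_resGalAuxOfEmb_apply]
  change r (ι z) = ι (τ' z)
  rw [hr]
  have h2 : e.symm (ι z) = z := by
    rw [← algEquivOfEmb_apply M ι z]
    exact e.symm_apply_apply z
  rw [h2]
  rfl

/-- **`[M : K]` kills `ker (H¹(K, E) → H¹(M, E))` for every finite extension `M/K`** of a
perfect field `K` (in particular of a number field), `E` any Weierstrass curve over `K`: the
corollary "`cor ∘ res = [M : K]`, so the kernel of `res` is `[M : K]`-torsion" of Serre, *Galois
Cohomology*, I.§2.4 (Cor. to Prop. 9), obtained without corestriction: a class dying over `M` is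
inflated from a crossed homomorphism vanishing on the open subgroup `Γ_F`, `F = e⁻¹(M) ⊂ K̄`
(`exists_intermediateField_fixingSubgroup_le_range_resGal`,
`Literature.NumberTheory.EllipticCurves.resKer_le_range_inflClass`), such classes are killed by
the index (`Literature.NumberTheory.EllipticCurves.index_nsmul_inflClass`), and
`[Γ_K : Γ_F] = [F : K] = [M : K]` (`K̄/K` is Galois for `K` perfect; Mathlib's
`IntermediateField.finrank_eq_fixingSubgroup_index`). The Galois case is
`Literature.NumberTheory.EllipticCurves.finrank_nsmul_eq_zero_of_mem_localRestrictionKer`.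
[cite: SerreGaloisCohomology1997, I.§2.4 Cor. to Prop. 9] -/
theorem finrank_nsmul_mem_localRestrictionKer_eq_zero [PerfectField K] [FiniteDimensional K M]
    (W : WeierstrassCurve K) (c : W.galH1) (hc : c ∈ W.localRestrictionKer M) :
    Module.finrank K M • c = 0 := by
  haveI : IsGalois K (AlgebraicClosure K) := {}
  obtain ⟨F, hF, hrank, hle⟩ :=
    exists_intermediateField_fixingSubgroup_le_range_resGal (K := K) M
  haveI := hF
  let N : Subgroup (Field.absoluteGaloisGroup K) := F.fixingSubgroup
  have hopen : IsOpen (N : Set (Field.absoluteGaloisGroup K)) :=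
    IntermediateField.fixingSubgroup_isOpen F
  have hidx : N.index = Module.finrank K M := by
    rw [← hrank]
    exact (IntermediateField.finrank_eq_fixingSubgroup_index F).symm
  haveI : N.FiniteIndex := ⟨by rw [hidx]; exact Module.finrank_pos.ne'⟩
  have hle' : N ≤ ((resGal (K := K) M : Field.absoluteGaloisGroup M →ₜ*
      Field.absoluteGaloisGroup K) :
        Field.absoluteGaloisGroup M →* Field.absoluteGaloisGroup K).range :=
    hle
  obtain ⟨f, rfl⟩ := resKer_le_range_inflClass (resGal (K := K) M) (pointsMap W M)
    (pointsMap_smul W M) (pointsMapOfEmb_bijective M W _) N hopen hle' hc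
  rw [← hidx]
  exact index_nsmul_inflClass N hopen f

end CorRes

/-! ### The period divides the index -/

section PeriodDvdIndex

variable {K : Type u} [Field K] [PerfectField K] (W : WeierstrassCurve K)

/-- **The period divides every splitting degree**: if `η ∈ H¹(K, E)` dies over a finite
extension `M/K` then `P(η) = addOrderOf η ∣ [M : K]`
(`finrank_nsmul_mem_localRestrictionKer_eq_zero`). Clark–Sharif §1.3, eq. (1) (`P ∣ I`);
Serre, I.§2.4. [cite: ClarkSharif2010, §1.3 eq. (1)]
[cite: SerreGaloisCohomology1997, I.§2.4 Cor. to Prop. 9] -/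
theorem addOrderOf_dvd_of_mem_splittingDegrees {η : W.galH1} {d : ℕ}
    (hd : d ∈ splittingDegrees W η) : addOrderOf η ∣ d := by
  obtain ⟨M, _, _, _, rfl, hM⟩ := hd
  exact addOrderOf_dvd_of_nsmul_eq_zero (finrank_nsmul_mem_localRestrictionKer_eq_zero M W η hM)

/-- **`P ∣ I`: the period of a class of `H¹(K, E)` divides its index** (for `E` a Weierstrass
curve over a perfect field `K`, e.g. a number field). "It is well known (e.g. [WCII]) that the
period `P` and the index `I` of `C` satisfy the divisibilities `P ∣ I ∣ P²`" (Clark–Sharif §1.3,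
eq. (1), the first one). Proof: the period is a common divisor of the splitting degrees
(`addOrderOf_dvd_of_mem_splittingDegrees`), and the index is the greatest common divisor — if
`d` is a splitting degree, `lcm(I, P)` is again a common divisor, so `lcm(I, P) ≤ I`, whence
`lcm(I, P) = I` and `P ∣ I`; if there is no splitting degree, `I` is the junk value `0`
(`sSup` of all of `ℕ`) and `P ∣ 0`. [cite: ClarkSharif2010, §1.3 eq. (1)] -/
theorem addOrderOf_dvd_index (η : W.galH1) : addOrderOf η ∣ index W η := by
  by_cases hne : (splittingDegrees W η).Nonempty
  · obtain ⟨d, hd⟩ := hne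
    have hdpos : 0 < d := pos_of_mem_splittingDegrees hd
    have hbdd : BddAbove {g : ℕ | ∀ d ∈ splittingDegrees W η, g ∣ d} :=
      ⟨d, fun g hg ↦ Nat.le_of_dvd hdpos (hg d hd)⟩
    have hne' : ({g : ℕ | ∀ d ∈ splittingDegrees W η, g ∣ d}).Nonempty :=
      ⟨1, fun _ _ ↦ one_dvd _⟩
    have hI : index W η ∈ {g : ℕ | ∀ d ∈ splittingDegrees W η, g ∣ d} := Nat.sSup_mem hne' hbdd
    have hl : ∀ d' ∈ splittingDegrees W η, Nat.lcm (index W η) (addOrderOf η) ∣ d' :=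
      fun d' hd' ↦ Nat.lcm_dvd (hI d' hd') (addOrderOf_dvd_of_mem_splittingDegrees W hd')
    have hle : Nat.lcm (index W η) (addOrderOf η) ≤ index W η := le_csSup hbdd hl
    have hIpos : 0 < index W η := Nat.pos_of_dvd_of_pos (hI d hd) hdpos
    have hPpos : 0 < addOrderOf η :=
      Nat.pos_of_dvd_of_pos (addOrderOf_dvd_of_mem_splittingDegrees W hd) hdpos
    have hge : index W η ≤ Nat.lcm (index W η) (addOrderOf η) :=
      Nat.le_of_dvd (Nat.lcm_pos hIpos hPpos) (Nat.dvd_lcm_left _ _)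
    calc addOrderOf η ∣ Nat.lcm (index W η) (addOrderOf η) := Nat.dvd_lcm_right _ _
      _ = index W η := le_antisymm hle hge
  · have hnot : ¬ BddAbove {g : ℕ | ∀ d ∈ splittingDegrees W η, g ∣ d} := by
      rintro ⟨b, hb⟩
      have hmem : b + 1 ∈ {g : ℕ | ∀ d ∈ splittingDegrees W η, g ∣ d} :=
        fun d hd ↦ absurd ⟨d, hd⟩ hne
      exact Nat.not_succ_le_self b (hb hmem)
    change addOrderOf η ∣ sSup {g : ℕ | ∀ d ∈ splittingDegrees W η, g ∣ d}
    rw [Nat.sSup_of_not_bddAbove hnot]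
    exact dvd_zero _

/-! ### Cassels' `I = P` on `Ш`, reduced to the divisibility `I ∣ P` -/

/-- **`I = P` as soon as `I ∣ P`** (by `addOrderOf_dvd_index` and antisymmetry of divisibility
on `ℕ`). For `η ∈ Ш(E/K)` over a number field the hypothesis is the theorem of Cassels
(Arithmetic on curves of genus 1, IV, 1962) in the reading "(ii) (Cassels) `F` is global and
`C ∈ Ш(F, E)` [then `P = I`]" of Clark–Sharif §3.7, printed proof Clark 2006, Prop. 6 with
Prop. 5(a) (Brauer obstruction and the reciprocity law for `Br` of a number field).
[cite: ClarkSharif2010, §1.3 eq. (1) and §3.7 (ii)] -/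
theorem index_eq_addOrderOf_of_index_dvd (η : W.galH1) (h : index W η ∣ addOrderOf η) :
    index W η = addOrderOf η :=
  Nat.dvd_antisymm h (addOrderOf_dvd_index W η)

end PeriodDvdIndex

/-- **Cassels' `I = P` on `Ш` from its hard half.** The named fact
`Literature.NumberTheory.EllipticCurves.Cassels1962_index_eq_period_of_mem_sha` of `PeriodIndex`
(for an elliptic curve `E` over a number field `K` and `η ∈ Ш(E/K)`, `I(η) = P(η)`) follows from
the divisibility `I ∣ P` on `Ш` alone — the content of Cassels 1962 / Clark 2006, Prop. 6 with
Prop. 5(a): "every rational divisor class on `C` admits a rational divisor. In particular, the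
period and index of `η` are equal" (a rational divisor class of degree `P` exists as `P · η = 0`,
so `C` carries a rational divisor of degree `P`, and `I ∣ P`) — the divisibility `P ∣ I` being
proved (`addOrderOf_dvd_index`). The hypothesis is spelled out, not vendored as a further named
fact (D-0026): it needs the Brauer group of a number field with the Albert–Brauer–Hasse–Noether
theorem (global class field theory) and the torsor dictionary for `H¹(K, E)`, none of which is
in Mathlib. [cite: ClarkSharif2010, §3.7 (ii) and §1.3 (reporting Cassels1962ArithmeticIV)]
[cite: Clark2006Crelle, Prop. 6 with Prop. 5(a)] -/
theorem Cassels1962_index_eq_period_of_mem_sha_of_index_dvd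
    (h : ∀ {K : Type u} [Field K] [NumberField K] (W : WeierstrassCurve K) [W.IsElliptic]
      (η : W.galH1), η ∈ W.sha → index W η ∣ addOrderOf η) :
    Cassels1962_index_eq_period_of_mem_sha.{u} :=
  fun W _ η hη ↦ index_eq_addOrderOf_of_index_dvd W η (h W η hη)

/-! ### Every class splits over a finite extension: splitting degrees exist, `H¹` is torsion -/

section SplitsSomewhere

variable {K : Type u} [Field K]

/-- **`Γ_F → Γ_K` lands in `Gal(K̄/F)` when `F ⊂ K̄` is normal over `K`.** For an intermediate
field `F` of `K̄/K`, normal over `K`, the restriction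
`Literature.NumberTheory.EllipticCurves.resGal F` of `σ ∈ Γ_F = Gal(F̄/F)` to `K̄` along the
chosen `K`-embedding `ι : K̄ → F̄` fixes `F` pointwise: `ι` maps `F` into the canonical copy of
`F` in `F̄` because `F/K` is normal (Mathlib's `AlgHom.restrictNormal_commutes`), so
`ι (σ|_{K̄} y) = σ (ι y) = ι y` for `y ∈ F`, and `ι` is injective.
Serre, *Galois Cohomology*, II.§1.1. [folklore] -/
theorem resGal_mem_fixingSubgroup_of_normal (F : IntermediateField K (AlgebraicClosure K))
    [Normal K F] (x : Field.absoluteGaloisGroup F) :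
    resGal (K := K) F x ∈ F.fixingSubgroup := by
  refine (IntermediateField.mem_fixingSubgroup_iff _ _).mpr fun y hy ↦ ?_
  obtain ⟨t, ht⟩ : ∃ t : F, algebraMap F (AlgebraicClosure F) t = closureEmb (K := K) F y :=
    ⟨(closureEmb (K := K) F).restrictNormal F ⟨y, hy⟩,
      AlgHom.restrictNormal_commutes (closureEmb (K := K) F) F ⟨y, hy⟩⟩
  apply (closureEmb (K := K) F).toRingHom.injective
  refine (apply_resGalAuxOfEmb_apply (closureEmb (K := K) F) x y).trans ?_
  change _ = closureEmb (K := K) F y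
  rw [← ht]
  exact (show AlgebraicClosure F ≃ₐ[F] AlgebraicClosure F from x).commutes t

variable (W : WeierstrassCurve K)

/-- **Every class of `H¹(K, E)` dies over a finite normal extension of `K` inside `K̄`**
(`H¹(Γ_K, E(K̄)) = lim_→ H¹(Γ_K/U, E(K̄)^U)` over the open normal subgroups `U`: Serre, *Galois
Cohomology*, I.§2.2, Cor. 1 to Prop. 8). A continuous crossed homomorphism `φ : Γ_K → E(K̄)`
(discrete) vanishes on the open neighbourhood `φ⁻¹(0)` of `1`, which contains `Gal(K̄/F)` for a
finite normal `F/K` inside `K̄` (Krull topology, Mathlib's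
`krullTopology_mem_nhds_one_iff_of_normal`); the restriction `Γ_F → Γ_K` lands in `Gal(K̄/F)`
(`resGal_mem_fixingSubgroup_of_normal`), so `φ` pulls back to the zero cocycle on `Γ_F` and the
class of `φ` lies in `ker (H¹(K, E) → H¹(F, E))` (`WeierstrassCurve.localRestrictionKer`).
[cite: SerreGaloisCohomology1997, I.§2.2 Cor. 1 to Prop. 8] -/
theorem exists_normal_mem_localRestrictionKer (c : W.galH1) :
    ∃ F : IntermediateField K (AlgebraicClosure K), FiniteDimensional K F ∧ Normal K F ∧
      c ∈ W.localRestrictionKer F := by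
  obtain ⟨φ, rfl⟩ := GaloisRepresentations.oneCocycleClass_surjective
    (discreteTopRep (Field.absoluteGaloisGroup K) (WeierstrassCurve.geomPoints W)) c
  have hcont :
      Continuous (fun g : Field.absoluteGaloisGroup K ↦ (φ.1 g : WeierstrassCurve.geomPoints W)) :=
    φ.1.continuous
  have h1 : (1 : Field.absoluteGaloisGroup K) ∈
      (fun g : Field.absoluteGaloisGroup K ↦ (φ.1 g : WeierstrassCurve.geomPoints W)) ⁻¹' {0} :=
    GaloisRepresentations.contOneCocycles.apply_one φ
  have hU :
      (fun g : Field.absoluteGaloisGroup K ↦ (φ.1 g : WeierstrassCurve.geomPoints W)) ⁻¹' {0} ∈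
        nhds (1 : Field.absoluteGaloisGroup K) :=
    (hcont.isOpen_preimage _ (isOpen_discrete _)).mem_nhds h1
  obtain ⟨F, hFfd, hFn, hF⟩ :=
    (krullTopology_mem_nhds_one_iff_of_normal K (AlgebraicClosure K) _).mp hU
  haveI := hFn
  refine ⟨F, hFfd, hFn, ?_⟩
  change GaloisRepresentations.oneCocycleClass _ φ ∈
    resKer (resGal (K := K) F) (pointsMap W F) (pointsMap_smul W F)
  rw [oneCocycleClass_mem_resKer_iff]
  refine ⟨0, fun x ↦ ?_⟩
  have hx : φ.1 (resGal (K := K) F x) = 0 := hF (resGal_mem_fixingSubgroup_of_normal F x)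
  rw [hx, map_zero, smul_zero, sub_zero]

/-- **Every class of `H¹(K, E)` has a splitting degree**: the set `splittingDegrees W η` of the
degrees of the finite extensions of `K` killing `η` is nonempty (Clark–Sharif §1.1 take the gcd
of this set as the definition of the index; `exists_normal_mem_localRestrictionKer`).
[cite: ClarkSharif2010, §1.1] [cite: SerreGaloisCohomology1997, I.§2.2 Cor. 1 to Prop. 8] -/
theorem splittingDegrees_nonempty (η : W.galH1) : (splittingDegrees W η).Nonempty := by
  obtain ⟨F, hF, -, hη⟩ := exists_normal_mem_localRestrictionKer W η
  haveI := hF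
  exact ⟨Module.finrank K F, F, inferInstance, inferInstance, hF, rfl, hη⟩

/-- **The index of a class of `H¹(K, E)` is never the junk value `0`**: it divides a splitting
degree (`index_dvd_of_mem_splittingDegrees`, `splittingDegrees_nonempty`), which is positive.
So `Literature.NumberTheory.EllipticCurves.index W η` is the gcd of the splitting degrees of `η`
for every class `η`, as in Clark–Sharif §1.1. [cite: ClarkSharif2010, §1.1] -/
theorem index_ne_zero (η : W.galH1) : index W η ≠ 0 := by
  obtain ⟨d, hd⟩ := splittingDegrees_nonempty W η
  exact (Nat.pos_of_dvd_of_pos (index_dvd_of_mem_splittingDegrees W hd)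
    (pos_of_mem_splittingDegrees hd)).ne'

/-- The index of a class of `H¹(K, E)` is positive (`index_ne_zero`).
[cite: ClarkSharif2010, §1.1] -/
theorem index_pos (η : W.galH1) : 0 < index W η :=
  Nat.pos_of_ne_zero (index_ne_zero W η)

variable [PerfectField K]

/-- **Every class of `H¹(K, E)` has finite order** (its period `P(η) = addOrderOf η` is positive),
for `E` a Weierstrass curve over a perfect field `K`: the period divides a splitting degree
(`addOrderOf_dvd_of_mem_splittingDegrees`, `splittingDegrees_nonempty`). Serre, I.§2.2, Cor. 3
to Prop. 8: "Pour `q ≥ 1`, les groupes `H^q(G, A)` sont des groupes de torsion."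
[cite: SerreGaloisCohomology1997, I.§2.2 Cor. 3 to Prop. 8] [cite: ClarkSharif2010, §1.1] -/
theorem galH1_addOrderOf_pos (η : W.galH1) : 0 < addOrderOf η := by
  obtain ⟨d, hd⟩ := splittingDegrees_nonempty W η
  exact Nat.pos_of_dvd_of_pos (addOrderOf_dvd_of_mem_splittingDegrees W hd)
    (pos_of_mem_splittingDegrees hd)

/-- Every class of `H¹(K, E)` is of finite additive order (`galH1_addOrderOf_pos`).
[cite: SerreGaloisCohomology1997, I.§2.2 Cor. 3 to Prop. 8] -/
theorem galH1_isOfFinAddOrder (η : W.galH1) : IsOfFinAddOrder η :=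
  addOrderOf_pos_iff.mp (galH1_addOrderOf_pos W η)

/-- **`H¹(K, E)` is a torsion group** (the Weil–Châtelet group of a Weierstrass curve over a
perfect field). Serre, *Galois Cohomology*, I.§2.2, Cor. 3 to Prop. 8.
[cite: SerreGaloisCohomology1997, I.§2.2 Cor. 3 to Prop. 8] -/
theorem galH1_isTorsion : AddMonoid.IsTorsion W.galH1 :=
  fun η ↦ galH1_isOfFinAddOrder W η

end SplitsSomewhere

/-! ### Cassels' theorem in Selmer form

Clark 2006, first proof of Prop. 6 (p. 4): "for any elliptic curve `E/K` defined over a field of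
characteristic zero and positive integer `n`, there exists a map `Δ : H¹(K, E[n]) → Br(K)[n]`,
functorial in `K`, and satisfying the following properties: a) a class `η ∈ H¹(K, E)[n]` has
index dividing `n` if and only if there exists some Kummer lift of `η` to `ξ ∈ H¹(K, E[n])` such
that `Δ(ξ) = 0`; b) if `η = 0` then every Kummer lift `ξ` of `η` has `Δ(ξ) = 0`. So let
`η ∈ 𝒦(K, E)` have period `n`, let `ξ` be any lift of `η` to `H¹(K, E[n])` and consider
`Δ(ξ) ∈ Br(K)[n]`. Since for all `v' ≠ v`, `η|_{v'} = 0`, by b) above we have that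
`Δ(ξ)|_{v'} = 0` in `Br(K_{v'})`. By virtue of the reciprocity law in the Brauer group of a number
field, we have that `Δ(ξ) = 0`, so `η` has index dividing `n`, hence index `n`."  For `η ∈ Ш`
the Kummer lifts `ξ` of `η` are exactly the Selmer classes above `η` (the tree's
`WeierstrassCurve.selmerGroup W n ⊆ H¹(K, E[n])` is the preimage of `Ш(E/K)`, and
`Sel^(n)(E/K) → Ш(E/K)[n]` is onto: Silverman, *AEC*, Thm. X.4.2(a), the tree's
`WeierstrassCurve.map_torsionH1ToH1_selmerGroup_holds`), so what the printed proof establishes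
is the **Selmer form** of Cassels' theorem: *for `n > 0`, the image in `H¹(K, E)` of every class
of the `n`-Selmer group has index dividing `n`*. This section proves that the Selmer form is
EQUIVALENT to the named fact `Cassels1962_index_eq_period_of_mem_sha` (so it is neither weaker
nor stronger): `index_torsionH1ToH1_dvd_of_mem_selmerGroup` (from the fact) and
`Cassels1962_index_eq_period_of_mem_sha_of_selmer` (to the fact, through
`Cassels1962_index_eq_period_of_mem_sha_of_index_dvd` and `P ∣ I`). No new named fact is
introduced (D-0026); the Selmer form is spelled out as a hypothesis/conclusion. -/

section SelmerForm

variable {K : Type u} [Field K] [NumberField K] (W : WeierstrassCurve K)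

/-- **Selmer classes map into `Ш`.** For `n ≠ 0` and `ξ ∈ Sel^(n)(E/K)`, the image of `ξ` under
`H¹(K, E[n]) → H¹(K, E)` lies in `Ш(E/K)` (and is killed by `n`): the containment "`⊆`" of
Silverman, *AEC*, Thm. X.4.2(a) (`WeierstrassCurve.map_torsionH1ToH1_selmerGroup_holds`:
the image of `Sel^(n)` is `Ш ∩ H¹(K, E)[n]`). [cite: SilvermanAEC2009, Thm X.4.2(a)] -/
theorem torsionH1ToH1_mem_sha_of_mem_selmerGroup {n : ℤ} (hn : n ≠ 0) {ξ : W.galH1Torsion n}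
    (hξ : ξ ∈ W.selmerGroup n) : W.torsionH1ToH1 n ξ ∈ W.sha := by
  have hmem : W.torsionH1ToH1 n ξ ∈ (W.selmerGroup n).map (W.torsionH1ToH1 n) :=
    AddSubgroup.mem_map_of_mem _ hξ
  rw [WeierstrassCurve.map_torsionH1ToH1_selmerGroup_holds W hn] at hmem
  exact hmem.1

/-- **Every class of `Ш` killed by `n ≠ 0` lifts to the `n`-Selmer group**: the surjectivity
`Sel^(n)(E/K) ↠ Ш(E/K)[n]` of Silverman, *AEC*, Thm. X.4.2(a)
(`WeierstrassCurve.map_torsionH1ToH1_selmerGroup_holds`), elementwise.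
[cite: SilvermanAEC2009, Thm X.4.2(a)] -/
theorem exists_mem_selmerGroup_of_mem_sha {n : ℤ} (hn : n ≠ 0) {η : W.galH1} (hη : η ∈ W.sha)
    (hnη : n • η = 0) : ∃ ξ ∈ W.selmerGroup n, W.torsionH1ToH1 n ξ = η := by
  have hmem : η ∈ (W.selmerGroup n).map (W.torsionH1ToH1 n) := by
    rw [WeierstrassCurve.map_torsionH1ToH1_selmerGroup_holds W hn]
    exact ⟨hη, hnη⟩
  exact AddSubgroup.mem_map.mp hmem

/-- **Cassels' theorem implies its Selmer form.** Granted
`Cassels1962_index_eq_period_of_mem_sha` (`I = P` on `Ш`), for an elliptic curve `E` over a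
number field `K`, `n > 0` and `ξ ∈ Sel^(n)(E/K)`, the image `η` of `ξ` in `H¹(K, E)` has index
dividing `n`: `η ∈ Ш` (`torsionH1ToH1_mem_sha_of_mem_selmerGroup`) and `n · η = 0`
(`WeierstrassCurve.torsionH1ToH1_mem_torsionBy`), so `I(η) = P(η) ∣ n`. This is the statement
the first printed proof of Clark 2006, Prop. 6 arrives at ("so `η` has index dividing `n`").
[cite: Clark2006Crelle, Prop. 6, first proof] [cite: ClarkSharif2010, §3.7 (ii)] -/
theorem index_torsionH1ToH1_dvd_of_mem_selmerGroup
    (hC : Cassels1962_index_eq_period_of_mem_sha.{u}) [W.IsElliptic] {n : ℕ} (hn : 0 < n)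
    {ξ : W.galH1Torsion n} (hξ : ξ ∈ W.selmerGroup n) :
    index W (W.torsionH1ToH1 n ξ) ∣ n := by
  have hn' : (n : ℤ) ≠ 0 := by exact_mod_cast hn.ne'
  rw [hC W _ (torsionH1ToH1_mem_sha_of_mem_selmerGroup W hn' hξ)]
  apply addOrderOf_dvd_of_nsmul_eq_zero
  have h := WeierstrassCurve.torsionH1ToH1_mem_torsionBy W n ξ
  change ((n : ℤ)) • W.torsionH1ToH1 n ξ = 0 at h
  rwa [natCast_zsmul] at h

/-- **The Selmer form gives `I ∣ P` on `Ш`, curve by curve.** If for every `n > 0` the image in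
`H¹(K, E)` of every class of `Sel^(n)(E/K)` has index dividing `n`, then every `η ∈ Ш(E/K)` has
`I(η) ∣ P(η)`: take `n = P(η) = addOrderOf η` (positive, `galH1_addOrderOf_pos`) and a Selmer
lift `ξ ↦ η` (`exists_mem_selmerGroup_of_mem_sha`, Silverman X.4.2(a)). With O'Neil's
obstruction map this is the first printed proof of Clark 2006, Prop. 6 for `η ∈ Ш ⊆ 𝒦(K, E)`
(Prop. 5(a)). [cite: Clark2006Crelle, Prop. 6 with Prop. 5(a)]
[cite: SilvermanAEC2009, Thm X.4.2(a)] -/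
theorem index_dvd_addOrderOf_of_mem_sha_of_selmer
    (h : ∀ {n : ℕ}, 0 < n → ∀ ξ ∈ W.selmerGroup n, index W (W.torsionH1ToH1 n ξ) ∣ n)
    {η : W.galH1} (hη : η ∈ W.sha) : index W η ∣ addOrderOf η := by
  have hP : 0 < addOrderOf η := galH1_addOrderOf_pos W η
  have hP' : ((addOrderOf η : ℕ) : ℤ) ≠ 0 := by exact_mod_cast hP.ne'
  have hnη : ((addOrderOf η : ℕ) : ℤ) • η = 0 := by
    rw [natCast_zsmul]
    exact addOrderOf_nsmul_eq_zero η
  obtain ⟨ξ, hξ, hξη⟩ := exists_mem_selmerGroup_of_mem_sha W hP' hη hnη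
  have hdvd := h hP ξ hξ
  rwa [hξη] at hdvd

/-- **Cassels' `I = P` on `Ш` from its Selmer form.** The named fact
`Literature.NumberTheory.EllipticCurves.Cassels1962_index_eq_period_of_mem_sha` of `PeriodIndex`
follows from: *for every elliptic curve `E` over a number field `K`, every `n > 0` and every
`ξ ∈ Sel^(n)(E/K)`, the image of `ξ` in `H¹(K, E)` has index dividing `n`* — the statement
established by the first printed proof of Clark 2006, Prop. 6 (O'Neil's obstruction
`Δ : H¹(K, E[n]) → Br(K)[n]` vanishes on a Selmer class locally at every place by property b)
and functoriality, hence globally "by virtue of the reciprocity law in the Brauer group of a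
number field", and then property a) gives `I ∣ n`), combined with `P ∣ I`
(`addOrderOf_dvd_index`) through `Cassels1962_index_eq_period_of_mem_sha_of_index_dvd` and
`index_dvd_addOrderOf_of_mem_sha_of_selmer`. Together with
`index_torsionH1ToH1_dvd_of_mem_selmerGroup` this shows the Selmer form is equivalent to the
named fact (`Cassels1962_index_eq_period_of_mem_sha_iff_selmer`). The hypothesis is spelled out,
not vendored as a named fact (D-0026).
[cite: Clark2006Crelle, Prop. 6 (first proof) with Prop. 5(a)]
[cite: ClarkSharif2010, §3.7 (ii) and §1.3 (reporting Cassels1962ArithmeticIV)] -/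
theorem Cassels1962_index_eq_period_of_mem_sha_of_selmer
    (h : ∀ {K : Type u} [Field K] [NumberField K] (W : WeierstrassCurve K) [W.IsElliptic] {n : ℕ},
      0 < n → ∀ ξ ∈ W.selmerGroup n, index W (W.torsionH1ToH1 n ξ) ∣ n) :
    Cassels1962_index_eq_period_of_mem_sha.{u} :=
  Cassels1962_index_eq_period_of_mem_sha_of_index_dvd fun W _ _ hη ↦
    index_dvd_addOrderOf_of_mem_sha_of_selmer W (fun hn ↦ h W hn) hη

/-- **Cassels' `I = P` on `Ш` is equivalent to its Selmer form** (for every elliptic curve over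
a number field, every `n > 0` and every `ξ ∈ Sel^(n)(E/K)`, the image of `ξ` in `H¹(K, E)` has
index dividing `n`): `index_torsionH1ToH1_dvd_of_mem_selmerGroup` and
`Cassels1962_index_eq_period_of_mem_sha_of_selmer`.
[cite: Clark2006Crelle, Prop. 6 (first proof) with Prop. 5(a)]
[cite: ClarkSharif2010, §3.7 (ii)] -/
theorem Cassels1962_index_eq_period_of_mem_sha_iff_selmer :
    Cassels1962_index_eq_period_of_mem_sha.{u} ↔
      ∀ {K : Type u} [Field K] [NumberField K] (W : WeierstrassCurve K) [W.IsElliptic] {n : ℕ},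
        0 < n → ∀ ξ ∈ W.selmerGroup n, index W (W.torsionH1ToH1 n ξ) ∣ n :=
  ⟨fun hC _ _ _ W _ _ hn _ hξ ↦ index_torsionH1ToH1_dvd_of_mem_selmerGroup W hC hn hξ,
    fun h ↦ Cassels1962_index_eq_period_of_mem_sha_of_selmer h⟩

end SelmerForm

/-! ### The standard trick: reduction to classes of prime-power period

Clark–Sharif, §3 (opening paragraph): "We first remind the reader of a standard trick: in all
work on the period-index problem it suffices to treat the case where the period `P` is a prime
power `P = p^a`. Indeed, if a class `η ∈ H¹(K, E)` (or any other Galois cohomology group, for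
that matter) has period `P = p_1^{a_1} ⋯ p_r^{a_r}`, then putting `η_i = (P / p_i^{a_i}) η`, one
easily checks that `η = Σ_{i=1}^r η_i` and that `I(η) = ∏_{i=1}^r I(η_i)`."  For Cassels'
theorem only the divisibility `I(Σ η_i) ∣ ∏ I(η_i)` is needed — the **sub-multiplicativity of
the index**, `index_add_dvd_mul_index`, from the common splitting fields of
`Literature.NumberTheory.EllipticCurves.exists_splittingDegrees_add` (`PeriodIndexProofs`): the
classes `η_i` are multiples of `η`, so lie in `Ш` with `η`, and have prime-power period
`p_i^{a_i}`; granted `I = P` for the classes of `Ш` of prime-power period,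
`I(η) ∣ ∏ I(η_i) = ∏ p_i^{a_i} = P(η)`, and `P ∣ I` (`addOrderOf_dvd_index`) finishes. So the
named fact `Cassels1962_index_eq_period_of_mem_sha` follows from (indeed is equivalent to) its
restriction to classes of prime-power period (`Cassels1962_index_eq_period_of_mem_sha_iff_isPrimePow`),
and from its Selmer form at prime-power levels only
(`Cassels1962_index_eq_period_of_mem_sha_of_selmer_isPrimePow`) — the level at which theta
groups and O'Neil's obstruction map `Δ_{p^a}` are set up in Clark–Sharif §§2–3. No new named
fact is introduced (D-0026): the prime-power case is a hypothesis. -/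

section PrimaryReduction

variable {K : Type u} [Field K] (W : WeierstrassCurve K)

/-- **Sub-multiplicativity of the index**: over a field of characteristic `0`,
`I(δ + ε) ∣ I(δ) · I(ε)` for all `δ, ε ∈ H¹(K, E)`. From one splitting field `M` of `δ` and one
splitting field `N` of `ε`, `Literature.NumberTheory.EllipticCurves.exists_splittingDegrees_add`
produces common splitting fields of `δ + ε` (the fields `N[X]/(q)`, `q` running over the
irreducible factors over `N` of the minimal polynomial of a primitive element of `M/K`) whose
degrees add up to `[M : K] · [N : K]`; so `I(δ + ε) ∣ [M : K] · [N : K]` for all such `M`, `N`,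
whence `I(δ + ε) ∣ I(δ) · [N : K]` and then `I(δ + ε) ∣ I(δ) · I(ε)`
(`Literature.NumberTheory.EllipticCurves.dvd_mul_of_forall_dvd_mul`, the index being the gcd of
the splitting degrees, `Literature.NumberTheory.EllipticCurves.dvd_index_of_forall_dvd`;
splitting fields exist, `splittingDegrees_nonempty`). This is the half of "`I(η) = ∏ I(η_i)`"
of the standard trick that holds unconditionally. [cite: ClarkSharif2010, §3 (standard trick)] -/
theorem index_add_dvd_mul_index [CharZero K] (δ ε : W.galH1) :
    index W (δ + ε) ∣ index W δ * index W ε := by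
  obtain ⟨m₀, hm₀⟩ := splittingDegrees_nonempty W δ
  obtain ⟨n₀, hn₀⟩ := splittingDegrees_nonempty W ε
  -- from one splitting field each: common splitting fields with controlled degrees
  have key : ∀ m ∈ splittingDegrees W δ, ∀ n ∈ splittingDegrees W ε,
      index W (δ + ε) ∣ m * n := by
    rintro m ⟨M, _, _, _, rfl, hM⟩ n ⟨N, _, _, _, rfl, hN⟩
    obtain ⟨s, -, hs, hsum⟩ := exists_splittingDegrees_add W M N hM hN
    exact hsum ▸ Multiset.dvd_sum fun d hd ↦ index_dvd_of_mem_splittingDegrees W (hs d hd)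
  have h1 : ∀ n ∈ splittingDegrees W ε, index W (δ + ε) ∣ index W δ * n := fun n hn ↦
    dvd_mul_of_forall_dvd_mul (pos_of_mem_splittingDegrees hn)
      (fun c hc ↦ dvd_index_of_forall_dvd W ⟨m₀, hm₀⟩ hc) fun m hm ↦ key m hm n hn
  have h2 : index W (δ + ε) ∣ index W ε * index W δ :=
    dvd_mul_of_forall_dvd_mul (index_pos W δ)
      (fun c hc ↦ dvd_index_of_forall_dvd W ⟨n₀, hn₀⟩ hc) fun n hn ↦ by
        rw [mul_comm]
        exact h1 n hn
  rwa [mul_comm] at h2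

/-- **Sub-multiplicativity of the index, finite sums**: `I(Σ_{i ∈ s} η_i) ∣ ∏_{i ∈ s} I(η_i)`
over a field of characteristic `0` (`index_add_dvd_mul_index` and `I(0) = 1`).
[cite: ClarkSharif2010, §3 (standard trick)] -/
theorem index_sum_dvd_prod_index [CharZero K] {ι : Type*} (s : Finset ι) (η : ι → W.galH1) :
    index W (∑ i ∈ s, η i) ∣ ∏ i ∈ s, index W (η i) := by
  induction s using Finset.induction_on with
  | empty => rw [Finset.sum_empty, Finset.prod_empty, index_zero]
  | insert a s ha ih =>
    rw [Finset.sum_insert ha, Finset.prod_insert ha]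
    exact (index_add_dvd_mul_index W _ _).trans (mul_dvd_mul_left _ ih)

variable [NumberField K]

/-- **The standard trick on `Ш`, divisibility form.** Let `E` be a Weierstrass curve over a
number field `K` such that every class of `Ш(E/K)` of prime-power period has index dividing
its period. Then every `η ∈ Ш(E/K)` killed by `n` has `I(η) ∣ n`. Induction over the
factorisation of `n` into pairwise coprime prime powers (`Nat.recOnPosPrimePosCoprime`):
`n = p^k`: the period of `η` is `p^j`, `j ≤ k`, and either `η = 0` (`I(0) = 1`) or the
hypothesis applies; `n = ab` with `a, b > 1` coprime: `u a + v b = 1` gives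
`η = (v b) η + (u a) η` with `a · (v b) η = 0 = b · (u a) η`, both summands in `Ш`, so
`I(η) ∣ I((v b) η) · I((u a) η) ∣ a b` (`index_add_dvd_mul_index` and induction).
[cite: ClarkSharif2010, §3 (standard trick)] -/
theorem index_dvd_of_mem_sha_of_nsmul_eq_zero_of_isPrimePow
    (h : ∀ θ ∈ W.sha, IsPrimePow (addOrderOf θ) → index W θ ∣ addOrderOf θ)
    {n : ℕ} {η : W.galH1} (hη : η ∈ W.sha) (hn : n • η = 0) : index W η ∣ n := by
  induction n using Nat.recOnPosPrimePosCoprime generalizing η with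
  | prime_pow p k hp hk =>
    obtain ⟨j, hjk, hj⟩ := (Nat.dvd_prime_pow hp).mp (addOrderOf_dvd_of_nsmul_eq_zero hn)
    rcases Nat.eq_zero_or_pos j with rfl | hjpos
    · rw [pow_zero, AddMonoid.addOrderOf_eq_one_iff] at hj
      rw [hj, index_zero]
      exact one_dvd _
    · have hpp : IsPrimePow (addOrderOf η) := hj ▸ hp.isPrimePow.pow hjpos.ne'
      have hdvd : index W η ∣ addOrderOf η := h η hη hpp
      rw [hj] at hdvd
      exact hdvd.trans (pow_dvd_pow p hjk)
  | zero => exact dvd_zero _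
  | one =>
    rw [one_nsmul] at hn
    rw [hn, index_zero]
  | coprime a b ha hb hab iha ihb =>
    -- Bézout: `u a + v b = 1`, so `η = (v b) • η + (u a) • η`
    obtain ⟨u, v, huv⟩ := Nat.isCoprime_iff_coprime.mpr hab
    have hsplit : η = (v * (b : ℤ)) • η + (u * (a : ℤ)) • η := by
      rw [← add_zsmul, show v * (b : ℤ) + u * (a : ℤ) = 1 by linear_combination huv, one_zsmul]
    have hab0 : ((a * b : ℕ) : ℤ) • η = 0 := by rw [natCast_zsmul, hn]
    have h₁ : a • ((v * (b : ℤ)) • η) = 0 := by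
      rw [← natCast_zsmul, ← mul_zsmul,
        show (a : ℤ) * (v * (b : ℤ)) = v * ((a * b : ℕ) : ℤ) by push_cast; ring,
        mul_zsmul, hab0, zsmul_zero]
    have h₂ : b • ((u * (a : ℤ)) • η) = 0 := by
      rw [← natCast_zsmul, ← mul_zsmul,
        show (b : ℤ) * (u * (a : ℤ)) = u * ((a * b : ℕ) : ℤ) by push_cast; ring,
        mul_zsmul, hab0, zsmul_zero]
    rw [hsplit]
    exact (index_add_dvd_mul_index W _ _).trans
      (mul_dvd_mul (iha (W.sha.zsmul_mem hη _) h₁) (ihb (W.sha.zsmul_mem hη _) h₂))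

/-- **The standard trick on `Ш`**: if every class of `Ш(E/K)` of prime-power period has index
dividing its period, then `I(η) ∣ P(η)` for every `η ∈ Ш(E/K)`
(`index_dvd_of_mem_sha_of_nsmul_eq_zero_of_isPrimePow` with `n = P(η) = addOrderOf η`).
[cite: ClarkSharif2010, §3 (standard trick)] -/
theorem index_dvd_addOrderOf_of_mem_sha_of_isPrimePow
    (h : ∀ θ ∈ W.sha, IsPrimePow (addOrderOf θ) → index W θ ∣ addOrderOf θ)
    {η : W.galH1} (hη : η ∈ W.sha) : index W η ∣ addOrderOf η :=
  index_dvd_of_mem_sha_of_nsmul_eq_zero_of_isPrimePow W h hη (addOrderOf_nsmul_eq_zero η)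

/-- **Cassels' `I = P` on `Ш` from its prime-power case.** The named fact
`Literature.NumberTheory.EllipticCurves.Cassels1962_index_eq_period_of_mem_sha` of `PeriodIndex`
(for an elliptic curve `E` over a number field `K` and `η ∈ Ш(E/K)`, `I(η) = P(η)`) follows from
its restriction to the classes `η ∈ Ш(E/K)` of prime-power period `P(η) = p^a` — "in all work
on the period-index problem it suffices to treat the case where the period `P` is a prime power"
(Clark–Sharif §3): `index_dvd_addOrderOf_of_mem_sha_of_isPrimePow` (sub-multiplicativity of the
index over the primary decomposition of `η` inside `Ш`) and `P ∣ I`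
(`Cassels1962_index_eq_period_of_mem_sha_of_index_dvd`). The prime-power case is a hypothesis,
not a further named fact (D-0026); it is the case treated by theta groups of level `p^a` and
O'Neil's obstruction map `Δ_{p^a}`. [cite: ClarkSharif2010, §3 (standard trick) and §3.7 (ii)]
[cite: Clark2006Crelle, Prop. 6 with Prop. 5(a)] -/
theorem Cassels1962_index_eq_period_of_mem_sha_of_isPrimePow
    (h : ∀ {K : Type u} [Field K] [NumberField K] (W : WeierstrassCurve K) [W.IsElliptic]
      (η : W.galH1), η ∈ W.sha → IsPrimePow (addOrderOf η) → index W η = addOrderOf η) :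
    Cassels1962_index_eq_period_of_mem_sha.{u} :=
  Cassels1962_index_eq_period_of_mem_sha_of_index_dvd fun W _ _ hη ↦
    index_dvd_addOrderOf_of_mem_sha_of_isPrimePow W
      (fun θ hθ hpp ↦ dvd_of_eq (h W θ hθ hpp)) hη

/-- **Cassels' `I = P` on `Ш` is equivalent to its prime-power case** (the standard trick,
`Cassels1962_index_eq_period_of_mem_sha_of_isPrimePow`; the converse is specialisation).
[cite: ClarkSharif2010, §3 (standard trick) and §3.7 (ii)] -/
theorem Cassels1962_index_eq_period_of_mem_sha_iff_isPrimePow :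
    Cassels1962_index_eq_period_of_mem_sha.{u} ↔
      ∀ {K : Type u} [Field K] [NumberField K] (W : WeierstrassCurve K) [W.IsElliptic]
        (η : W.galH1), η ∈ W.sha → IsPrimePow (addOrderOf η) → index W η = addOrderOf η :=
  ⟨fun hC _ _ _ W _ η hη _ ↦ hC W η hη,
    fun h ↦ Cassels1962_index_eq_period_of_mem_sha_of_isPrimePow h⟩

/-- **Cassels' `I = P` on `Ш` from its Selmer form at prime-power levels.** The named fact
`Literature.NumberTheory.EllipticCurves.Cassels1962_index_eq_period_of_mem_sha` follows from:
*for every elliptic curve `E` over a number field `K`, every prime power `n = p^a` and every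
`ξ ∈ Sel^(n)(E/K)`, the image of `ξ` in `H¹(K, E)` has index dividing `n`* — the Selmer form
(`Cassels1962_index_eq_period_of_mem_sha_of_selmer`: what the first printed proof of Clark 2006,
Prop. 6 establishes, via O'Neil's obstruction map and the reciprocity law for `Br(K)`)
restricted to the prime-power levels at which Clark–Sharif §§2–3 set up theta groups and
`Δ_{p^a}`. Proof: a class `η ∈ Ш` of prime-power period `n = P(η)` lifts to `Sel^(n)(E/K)`
(`exists_mem_selmerGroup_of_mem_sha`, Silverman X.4.2(a)), so `I(η) ∣ n = P(η)` and `I(η) = P(η)`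
(`index_eq_addOrderOf_of_index_dvd`); then `Cassels1962_index_eq_period_of_mem_sha_of_isPrimePow`.
The hypothesis is spelled out, not vendored as a named fact (D-0026).
[cite: Clark2006Crelle, Prop. 6 (first proof) with Prop. 5(a)]
[cite: ClarkSharif2010, §3 (standard trick) and §3.7 (ii)] [cite: SilvermanAEC2009, Thm X.4.2(a)] -/
theorem Cassels1962_index_eq_period_of_mem_sha_of_selmer_isPrimePow
    (h : ∀ {K : Type u} [Field K] [NumberField K] (W : WeierstrassCurve K) [W.IsElliptic] {n : ℕ},
      IsPrimePow n → ∀ ξ ∈ W.selmerGroup n, index W (W.torsionH1ToH1 n ξ) ∣ n) :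
    Cassels1962_index_eq_period_of_mem_sha.{u} := by
  refine Cassels1962_index_eq_period_of_mem_sha_of_isPrimePow fun W _ η hη hpp ↦
    index_eq_addOrderOf_of_index_dvd W η ?_
  have hP : 0 < addOrderOf η := hpp.pos
  have hP' : ((addOrderOf η : ℕ) : ℤ) ≠ 0 := by exact_mod_cast hP.ne'
  have hnη : ((addOrderOf η : ℕ) : ℤ) • η = 0 := by
    rw [natCast_zsmul]
    exact addOrderOf_nsmul_eq_zero η
  obtain ⟨ξ, hξ, hξη⟩ := exists_mem_selmerGroup_of_mem_sha W hP' hη hnη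
  have hdvd := h W hpp ξ hξ
  rwa [hξη] at hdvd

end PrimaryReduction

end Literature.NumberTheory.EllipticCurves

end
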